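import Summits.HodgeConjecture.HodgeConjecture.Theorems.Ring2AbelianAllAndreTwistedSquareEvenInhabitants
import Summits.HodgeConjecture.HodgeConjecture.Theorems.Ring2AbelianAllAndreEvenNonsplitPencils
import HarnessLib

/-!
# Ring 2 · AbelianAll — ANDRÉ AXIS, PART Q-d: AN UNCONDITIONAL ANCHOR ON EVERY COMPONENT — for every polarized component `(n, d, δ)` of the
  imaginary-quadratic Weil tower with `sign δ = (−1)ⁿ`, `n ≥ 2`, ONE polarized Weil variety `A₀` in it satisfying the Hodge conjecture such that on
  EVERY compact pencil with its `K`-action through a chart `K`-isogenous to `A₀`: `B⋆` of the ONE total space ⟹ the Weil Hodge conjecture for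
  every member (fact-free), `⟺` modulo Verdier

HONEST FRAMING (page 1, verbatim): **research route, not a corollary; conditional on HC_CM plus one named minimal statement.** Cell line:
research route conditional on HC_CM; not a corollary; Q11.4-sentence-2 already refuted in dim ≥ 3. Nothing in this file proves a case of the
Hodge conjecture (beyond the tree's powers of a CM elliptic curve) or of `B(X)` for a named `X`: the rows are IMPLICATIONS with displayed
hypotheses. `HC_CM`, `HC_AV` and the global nodes do NOT occur. NAMED-FACT BINDER (hypothesis of the `⟺` row only): `hGT` = Verdier 1976.
Item `Theses.RankFourFaces.CMToAbelian` (stmt-16267) stays OPEN; N104 untouched; no node is born (0 `def`, 0 `sorry`). Seat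
`pub-hodge-ring2-ab-andre-2`, gen 47 (part Q). Inputs: part Q-b §6 (`exists_hodge_polarized_weilVariety_of_weilSign`: the parity-free anchor —
part O-d for odd `n`, part Q-b §5 for even `n`), part N §3 (`weilClassesOf_le_algebraicClasses_forall_of_lefschetzB_of_hodgeConjectureFor_chart`,
`lefschetzB_weilPencil_iff_forall_weilClasses_algebraic_of_hodgeConjectureFor_chart_of_verdier`), «Weil type and HC pass along a `K`-isogeny»
(`IsWeilType.of_isIsogeny'`, `HodgeConjectureFor.of_isIsogenous`).

## Content (theorems only; standard axioms)

* **`exists_hodgeAnchor_forall_weilPencil_of_weilSign`** — THE CAPSTONE OF PARTS M-d/N/O/Q IN ONE STATEMENT: for `n = q + 1 ≥ 2`, `d ≥ 1` and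
  every `c ∈ ℚˣ` with `sign [c] = (−1)ⁿ` there are `(A₀, φ₀, e₀, a₀)` — `dim A₀ = 2n`, `φ₀² = −d`, Weil type `(n, d)`, `K`-symmetrised hyperplane class
  of non-degenerate discriminant class `[c]`, algebraic Weil plane, `HodgeConjectureFor A₀` — such that for EVERY compact pencil `f : 𝒳 ⟶ S` of
  abelian `2n`-folds with `B⋆(𝒳, η) ∀η`, a global endomorphism `Φ` over `S`, `K`-compatible charts `(A_s, e_s, φ_s)` (`φ_s² = −d`), a global
  `U₊` on the Weil line at `t` with `U₊|X_t ≠ 0`, and a `K`-isogeny `g : A_t ⟶ A₀` (`g ≫ φ₀ = φ_t ≫ g`): `W(A_s, φ_s) ⊆ Nⁿ(A_s)` for EVERY `s`.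
  Fact-free; no `HC_CM`; no Hodge–Weil theorem in print; no θ_N, no group law, no Verdier.
* **`exists_hodgeAnchor_forall_weilPencil_iff_of_verdier_of_weilSign`** — the same anchor with part N's `⟺` row: with the Tankeev data (θ_N-datum
  `ν`, group law `mS` charted at `t`, lines off the middle degree, no odd invariants, `Θ, U₊, U₋` spanning the middle invariants at `t`, `Θ|X_s`
  algebraic), `B⋆(𝒳, η) ∀η ⟺ W(A_s, φ_s) ⊆ Nⁿ(A_s) ∀s`, modulo Verdier for `⟸`.

## Honest status

Packaging only (∃ anchor ∀ pencils): the anchor is part O-d's `E₀^{2k+1} × Ē₀^{2k+1}` (odd `n`) or part Q-b's `E₀^{2j+2} × Ē₀^{2j+2}` (even `n`);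
the row is part N's. What it makes quotable: the one-total-space reduction of the André axis is available, with an UNCONDITIONAL anchor IN THE
COMPONENT, on every polarized component of the Weil tower — split (closed modulo the split rungs + Verdier, parts P-b/P-c) or non-split (open:
W₆ through `B × B̄`, the even habitat W₈, …). Existence of compact pencils with global `K`-action through a given anchor is NOT constructed
(hypotheses, as on the whole axis); the component's general member is untouched; nothing minimal claimed; N104 untouched.
EDGE LABELS: first theorem K (fact-free; hypothesis-free existence of the anchor); second K[Verdier] for `⟸`.
References: vanGeemen1994HodgeAV (4.9–4.11, 4.14, Lemma 5.2, 5.3–5.4); Deligne1982HodgeCycles (§4 Remark 4.10); Andre1996Motifs (§6.3 Lemme 6.3.3,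
Remarque 2); Tankeev2008 (Thm. (i)–(ii)); Verdier1976 (Cor. (5.1)); MoonenZarhin1999LowDim ((1.9): isogeny invariance).
-/

noncomputable section

set_option linter.dupNamespace false

namespace Summit.HodgeConjecture.HodgeConjecture.Ring2.AbelianAll

open CategoryTheory CategoryTheory.Limits AlgebraicGeometry MonoidalCategory CartesianMonoidalCategory
open Literature.AlgebraicGeometry Literature.AlgebraicGeometry.Motives
open Literature.AlgebraicGeometry.HodgeTheory Literature.AlgebraicGeometry.VanGeemen1994
open Literature.AlgebraicTopology.SingularHomology (singularCohomology)
open Summit.HodgeConjecture.CorCM.Model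

section Capstone

open scoped MonObj

/-- `𝒴` — the fibre square `𝒳 ×_S 𝒳` (display notation for the tree's `familyPullback f f`). -/
local notation3 (prettyPrint := false) "𝒴[" f "]" => familyPullback f f
/-- `𝐚` — the first projection `𝒳 ×_S 𝒳 ⟶ 𝒳`. -/
local notation3 (prettyPrint := false) "𝐚[" f "]" => familyPullback.fst f f
/-- `𝐛` — the second projection `𝒳 ×_S 𝒳 ⟶ 𝒳`. -/
local notation3 (prettyPrint := false) "𝐛[" f "]" => familyPullback.snd f f

/-- **AN UNCONDITIONAL ANCHOR ON EVERY COMPONENT, AND THE ONE-TOTAL-SPACE ROW THROUGH IT** (fact-free). For `n = q + 1 ≥ 2`, `d ≥ 1` and every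
`c ∈ ℚˣ` with `sign [c] = (−1)ⁿ`: a polarized Weil `2n`-fold `(A₀, φ₀, e₀, a₀)` of type `(n, d)` and discriminant class `[c]` — a twisted square of an
elliptic power (parts O-d / Q-b) — with algebraic Weil plane and the Hodge conjecture in every codimension, such that for EVERY compact pencil
`f : 𝒳 ⟶ S` of abelian `2n`-folds with `B⋆(𝒳, η) ∀η`, a global endomorphism `Φ` over `S`, `K`-compatible charts `(A_s, e_s, φ_s)` (`φ_s² = −d`), a
global `U₊` with `e_t^*(U₊|X_t) ∈ E₊(A_t, φ_t)`, `U₊|X_t ≠ 0`, and a `K`-isogeny `g : A_t ⟶ A₀`, the Weil classes of EVERY member are algebraic: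
`W(A_s, φ_s) ⊆ Nⁿ(A_s)`. Part N §3's row with Weil type and HC at the chart supplied by the anchor along the isogeny. No θ_N, no group law, no
Verdier, no `HC_CM`, no Hodge–Weil theorem in print. [cite: Andre1996Motifs, Prop. 3.3 (pp. 21–22), §6.3 Lemme 6.3.3 and Remarque 2 (p. 33)]
[cite: vanGeemen1994HodgeAV, 4.9–4.11, 4.14 and 5.3] [cite: Deligne1982HodgeCycles, §4 Remark 4.10] [cite: MoonenZarhin1999LowDim, (1.9)] -/
theorem exists_hodgeAnchor_forall_weilPencil_of_weilSign {q d : ℕ} (hq : 1 ≤ q) (hd : 0 < d) (c : ℚˣ)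
    (hc : weilSign d (QuotientGroup.mk c) = (-1) ^ (q + 1)) :
    ∃ (A₀ : AbelianVariety ℂ) (φ₀ : A₀ ⟶ A₀) (e₀ : ProjectiveEmbedding A₀.X) (a₀ : complexBetti (projectiveSpace e₀.n ℂ) 2),
      IsRationalClass a₀ ∧ a₀ ≠ 0 ∧ A₀.dim = 2 * (q + 1) ∧ φ₀ ≫ φ₀ = -(d • 𝟙 A₀) ∧ IsWeilType A₀ φ₀ (q + 1) d ∧
      HasWeilDiscriminantNondeg A₀ φ₀ (q + 1) d
        ((d : ℂ) • complexBetti.map e₀.ι 2 a₀ + complexBetti.map φ₀.hom.hom.hom 2 (complexBetti.map e₀.ι 2 a₀)) (QuotientGroup.mk c) ∧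
      weilClassesOf A₀ φ₀ (q + 1) d ≤ algebraicClasses A₀.X (q + 1) ∧ HodgeConjectureFor A₀.dim A₀.X ∧
      ∀ {𝒳 S : SchemeOver ℂ} {f : 𝒳 ⟶ S} (_hf : IsCompactAbelianPencil f (2 * q + 1 + 1))
        (_hB : ∀ ηX : complexBetti 𝒳 2, StandardConjectureBStar (2 * q + 1 + 1 + 1) 𝒳 ηX)
        (Φ : 𝒳 ⟶ 𝒳) (_hΦ : Φ ≫ f = f)
        (A : ComplexPoints S → AbelianVariety ℂ) (e : ∀ s, (A s).X ≅ fiberOver f s) (φ : ∀ s, A s ⟶ A s)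
        (_hφ : ∀ s, φ s ≫ φ s = -(d • 𝟙 (A s)))
        (_hK : ∀ s, ∃ Φs : fiberOver f s ⟶ fiberOver f s,
          Φs ≫ fiberι f s = fiberι f s ≫ Φ ∧ (e s).hom ≫ Φs = (φ s).hom.hom.hom ≫ (e s).hom)
        (Up : complexBetti 𝒳 (2 * (q + 1))) {t : ComplexPoints S}
        (_hUpt : complexBetti.map (e t).hom (2 * (q + 1)) (complexBetti.map (fiberι f t) (2 * (q + 1)) Up) ∈
          weilClassesPlus (A t) (φ t) (q + 1) d)
        (_hUp0 : complexBetti.map (fiberι f t) (2 * (q + 1)) Up ≠ 0)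
        (g : A t ⟶ A₀) (_hg : AbelianVariety.IsIsogeny g) (_hcomm : g ≫ φ₀ = φ t ≫ g) (s : ComplexPoints S),
        weilClassesOf (A s) (φ s) (q + 1) d ≤ algebraicClasses (A s).X (q + 1) := by
  obtain ⟨A₀, φ₀, e₀, a₀, ha, ha0, hdim, hφ₀, hW₀, hδ₀, hWalg₀, hHC₀⟩ :=
    exists_hodge_polarized_weilVariety_of_weilSign (n := q + 1) (by omega) hd c hc
  refine ⟨A₀, φ₀, e₀, a₀, ha, ha0, hdim, hφ₀, hW₀, hδ₀, hWalg₀, hHC₀, ?_⟩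
  intro 𝒳 S f hf hB Φ hΦ A e φ hφ hK Up t hUpt hUp0 g hg hcomm s
  exact weilClassesOf_le_algebraicClasses_forall_of_lefschetzB_of_hodgeConjectureFor_chart hf hB Φ hΦ A e φ hφ hK Up hUpt hUp0
    (hW₀.of_isIsogeny' g hg hcomm (hφ t)) (HodgeConjectureFor.of_isIsogenous ⟨g, hg⟩ hHC₀) s

/-- **The same anchor with the `⟺` row** (part N; Tankeev data displayed, Verdier for `⟸`): for every right-sign component `(q+1, d, [c])`, `q ≥ 1`,
ONE polarized Weil variety `A₀` in it satisfying the Hodge conjecture such that on every compact pencil of abelian `(2q+2)`-folds with θ_N-datum `ν`, an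
`S`-group law `mS` charted at `t`, rank-one invariants off the middle degree, no odd invariants, a global `Φ` with `K`-compatible charts, `Θ, U₊, U₋`
spanning `j_t^*H^{2q+2}(𝒳)` with `Θ|X_s` algebraic and `e_t^*(U_±|X_t) ∈ E_±`, `U₊|X_t ≠ 0`, and a `K`-isogeny `A_t ⟶ A₀`:
`B⋆(𝒳, η) ∀η ⟺ W(A_s, φ_s) ⊆ N^{q+1}(A_s) ∀s`. [cite: Tankeev2008, Thm. (i)–(ii)] [cite: Verdier1976, Cor. (5.1)]
[cite: Andre1996Motifs, §6.3 Lemme 6.3.3 and Remarque 2 (p. 33)] [cite: vanGeemen1994HodgeAV, 4.9–4.11 and Lemma 5.2 (6)] -/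
theorem exists_hodgeAnchor_forall_weilPencil_iff_of_verdier_of_weilSign (hGT : Verdier1976_genericLocalTriviality) {q d : ℕ} (hq : 1 ≤ q)
    (hd : 0 < d) (c : ℚˣ) (hc : weilSign d (QuotientGroup.mk c) = (-1) ^ (q + 1)) :
    ∃ (A₀ : AbelianVariety ℂ) (φ₀ : A₀ ⟶ A₀) (e₀ : ProjectiveEmbedding A₀.X) (a₀ : complexBetti (projectiveSpace e₀.n ℂ) 2),
      IsRationalClass a₀ ∧ a₀ ≠ 0 ∧ A₀.dim = 2 * (q + 1) ∧ φ₀ ≫ φ₀ = -(d • 𝟙 A₀) ∧ IsWeilType A₀ φ₀ (q + 1) d ∧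
      HasWeilDiscriminantNondeg A₀ φ₀ (q + 1) d
        ((d : ℂ) • complexBetti.map e₀.ι 2 a₀ + complexBetti.map φ₀.hom.hom.hom 2 (complexBetti.map e₀.ι 2 a₀)) (QuotientGroup.mk c) ∧
      HodgeConjectureFor A₀.dim A₀.X ∧
      ∀ {𝒳 S : SchemeOver ℂ} {f : 𝒳 ⟶ S} (_hf : IsCompactAbelianPencil f (2 * q + 1 + 1))
        (t : ComplexPoints S) (ν : 𝒳 ⟶ 𝒳) (hν : ν ≫ f = f) {N : ℕ} (_hN : 2 ≤ N)
        (_hθ : ∀ s : ComplexPoints S, ∃ (νs : fiberOver f s ⟶ fiberOver f s) (A : AbelianVariety ℂ) (e : A.X ≅ fiberOver f s),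
          νs ≫ fiberι f s = fiberι f s ≫ ν ∧ e.hom ≫ νs = (N • 𝟙 A).hom.hom.hom ≫ e.hom)
        (mS : 𝒴[f] ⟶ 𝒳)
        (_hmν : (familyPullback.isPullback f f).lift (𝐚[f] ≫ ν) (𝐛[f] ≫ ν) (familyPullback_pair_condition hν) ≫ mS = mS ≫ ν)
        (_hchart : ∃ (νt : fiberOver f t ⟶ fiberOver f t) (A : AbelianVariety ℂ) (e : A.X ≅ fiberOver f t),
          νt ≫ fiberι f t = fiberι f t ≫ ν ∧ e.hom ≫ νt = (N • 𝟙 A).hom.hom.hom ≫ e.hom ∧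
          (familyPullback.isPullback f f).lift (fst A.X A.X ≫ e.hom ≫ fiberι f t) (snd A.X A.X ≫ e.hom ≫ fiberι f t)
            (fibreChart_pair_condition t e) ≫ mS = μ[A.X] ≫ e.hom ≫ fiberι f t)
        (_hRank : ∀ p : ℕ, 0 < p → p < 2 * q + 1 + 1 → p ≠ q + 1 →
          Module.finrank ℂ (LinearMap.range (complexBetti.map (fiberι f t) (2 * p)).hom) = 1)
        (_hOdd : ∀ k' : ℕ, Odd k' → k' ≤ 2 * (2 * q + 1 + 1) → ∀ W : complexBetti 𝒳 k', complexBetti.map (fiberι f t) k' W = 0)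
        (Φ : 𝒳 ⟶ 𝒳) (_hΦ : Φ ≫ f = f)
        (A : ComplexPoints S → AbelianVariety ℂ) (e : ∀ s, (A s).X ≅ fiberOver f s) (φ : ∀ s, A s ⟶ A s)
        (_hφ : ∀ s, φ s ≫ φ s = -(d • 𝟙 (A s)))
        (_hK : ∀ s, ∃ Φs : fiberOver f s ⟶ fiberOver f s,
          Φs ≫ fiberι f s = fiberι f s ≫ Φ ∧ (e s).hom ≫ Φs = (φ s).hom.hom.hom ≫ (e s).hom)
        (Θ Up Um : complexBetti 𝒳 (2 * (q + 1)))
        (_hspan : ∀ W : complexBetti 𝒳 (2 * (q + 1)), ∃ a b c : ℂ, (complexBetti.map (fiberι f t) (2 * (q + 1))).hom W =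
          a • (complexBetti.map (fiberι f t) (2 * (q + 1))).hom Θ + b • (complexBetti.map (fiberι f t) (2 * (q + 1))).hom Up +
            c • (complexBetti.map (fiberι f t) (2 * (q + 1))).hom Um)
        (_hΘ : ∀ s : ComplexPoints S, (complexBetti.map (fiberι f s) (2 * (q + 1))).hom Θ ∈ algebraicClasses (fiberOver f s) (q + 1))
        (_hUpt : complexBetti.map (e t).hom (2 * (q + 1)) (complexBetti.map (fiberι f t) (2 * (q + 1)) Up) ∈
          weilClassesPlus (A t) (φ t) (q + 1) d)
        (_hUmt : complexBetti.map (e t).hom (2 * (q + 1)) (complexBetti.map (fiberι f t) (2 * (q + 1)) Um) ∈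
          weilClassesMinus (A t) (φ t) (q + 1) d)
        (_hUp0 : complexBetti.map (fiberι f t) (2 * (q + 1)) Up ≠ 0)
        (g : A t ⟶ A₀) (_hg : AbelianVariety.IsIsogeny g) (_hcomm : g ≫ φ₀ = φ t ≫ g),
        (∀ ηX : complexBetti 𝒳 2, StandardConjectureBStar (2 * q + 1 + 1 + 1) 𝒳 ηX) ↔
          ∀ s : ComplexPoints S, weilClassesOf (A s) (φ s) (q + 1) d ≤ algebraicClasses (A s).X (q + 1) := by
  obtain ⟨A₀, φ₀, e₀, a₀, ha, ha0, hdim, hφ₀, hW₀, hδ₀, -, hHC₀⟩ :=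
    exists_hodge_polarized_weilVariety_of_weilSign (n := q + 1) (by omega) hd c hc
  refine ⟨A₀, φ₀, e₀, a₀, ha, ha0, hdim, hφ₀, hW₀, hδ₀, hHC₀, ?_⟩
  intro 𝒳 S f hf t ν hν N hN hθ mS hmν hchart hRank hOdd Φ hΦ A e φ hφ hK Θ Up Um hspan hΘ hUpt hUmt hUp0 g hg hcomm
  exact lefschetzB_weilPencil_iff_forall_weilClasses_algebraic_of_hodgeConjectureFor_chart_of_verdier hGT hf t ν hν hN hθ mS hmν hchart
    hRank hOdd Φ hΦ A e φ hφ hK Θ Up Um hspan hΘ hUpt hUmt hUp0 (hW₀.of_isIsogeny' g hg hcomm (hφ t))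
    (HodgeConjectureFor.of_isIsogenous ⟨g, hg⟩ hHC₀)

end Capstone

end Summit.HodgeConjecture.HodgeConjecture.Ring2.AbelianAll

end
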